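import Mathlib
import Literature.MathematicalPhysics.StatisticalMechanics.Crystallization
import Literature.MathematicalPhysics.StatisticalMechanics.LennardJonesClusters
import Literature.MathematicalPhysics.StatisticalMechanics.MuGroundStateConfiguration

/-!
# `ExactCertificate` (stmt-AtomisticToContinuum-11959), line `closure-makes-nogap-exact`,
# Transfer1D skeleton (`Cruxes.ExactCertificate.Transfer1D.ExactCertificate1D`): stub `stub_tailFzero`

Support file for the crux `ThreeConeCertificate.ExactCertificate` (crux 11959), line
`closure-makes-nogap-exact`, TRANSFER skeleton `ExactCertificate1D` (the `d = 1` exact Lennard-Jones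
certificate).  With `V = lennardJones` and a lattice constant `a > 0`, the tail interpolant of the
skeleton is

  `F_a(x) := Σ_{k ≥ 0} (k+1)·[V(|x+a| + (k+1)a) − 2·V(|x| + (k+1)a) + V(|x−a| + (k+1)a)]`

(minus one quarter of the second difference of the retarded Green's function
`Ψ_a(x) = −4 Σ_{k ≥ 0} (k+1) V(|x| + (k+1)a)` of the discrete Laplacian `Δ_a`).  This file proves the
registered stub `stub_tailFzero`, i.e. the two TELESCOPING identities

* (i)  `F_a(x) = V(x)` for every `x ≥ a` (the far field is paid exactly): for `x ≥ a > 0` all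
  absolute values open up, the `k`-th term is `(k+1)(u_{k+2} − 2u_{k+1} + u_k)` with
  `u_m := V(x + m a)`, the partial sums are `K·u_{K+1} − (K+1)·u_K + u_0`, and both boundary terms
  tend to `0` by the decay `|V(r)| ≤ C r⁻⁶` (`r ≥ a`);
* (ii) `F_a(0) = −2 Σ_{m ≥ 1} V(m a)`: with `u_m := V(m a)` the `k`-th term is
  `2(k+1)(u_{k+2} − u_{k+1})`, the partial sums are `2K·u_{K+1} − 2 Σ_{m=1}^{K} u_m`.

Pure series bookkeeping: no zero-pressure condition, `a > 0` arbitrary.  The decay input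
`|V(t)| ≤ (ρ⁻⁶/12 + 1/6) t⁻⁶` (`t ≥ ρ > 0`) is the Literature lemma `abs_lennardJones_le_of_le`
(`MuGroundStateConfiguration`); helper lemmas here (prefixed `tailFzero_`): the termwise bound
`|V(c + (k+1)a)| ≤ C_a (k+1)⁻⁶`, the summability of `k ↦ (k+1) V(c + (k+1)a)` (`c ≥ 0`) and of
`k ↦ V((k+1)a)`.  All `[folklore]`.
-/

noncomputable section

namespace Summit.AtomisticToContinuum.Crystallization.Theorems.ThreeConeCertificateExactCertificate.Transfer1D

open Literature.MathematicalPhysics.StatisticalMechanics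
open Filter Topology
open scoped BigOperators

/-! ## Decay and summability of the Lennard-Jones tail -/

/-- Termwise decay along an arithmetic progression: for `a > 0`, `c ≥ 0` and `k : ℕ`,
`|V(c + (k+1)a)| ≤ (a⁻⁶/12 + 1/6) · a⁻⁶ · (k+1)⁻⁶` (since `c + (k+1)a ≥ (k+1)a ≥ a`, decay bound
`abs_lennardJones_le_of_le`). [folklore] -/
theorem tailFzero_abs_lennardJones_shift_le {a c : ℝ} (ha : 0 < a) (hc : 0 ≤ c) (k : ℕ) :
    |lennardJones (c + ((k : ℝ) + 1) * a)| ≤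
      (a⁻¹ ^ 6 / 12 + 1 / 6) * a⁻¹ ^ 6 * (((k : ℝ) + 1) ^ 6)⁻¹ := by
  have hk : (0 : ℝ) < (k : ℝ) + 1 := by positivity
  have hka : 0 < ((k : ℝ) + 1) * a := mul_pos hk ha
  have hk0 : (0 : ℝ) ≤ (k : ℝ) * a := mul_nonneg (Nat.cast_nonneg k) ha.le
  have h1 : a ≤ c + ((k : ℝ) + 1) * a := by linarith
  have h2 : ((k : ℝ) + 1) * a ≤ c + ((k : ℝ) + 1) * a := by linarith
  calc |lennardJones (c + ((k : ℝ) + 1) * a)|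
      ≤ (a⁻¹ ^ 6 / 12 + 1 / 6) * (c + ((k : ℝ) + 1) * a)⁻¹ ^ 6 :=
        Literature.MathematicalPhysics.StatisticalMechanics.abs_lennardJones_le_of_le ha h1
    _ ≤ (a⁻¹ ^ 6 / 12 + 1 / 6) * (((k : ℝ) + 1) * a)⁻¹ ^ 6 :=
        mul_le_mul_of_nonneg_left (pow_le_pow_left₀ (by positivity) (inv_anti₀ hka h2) 6)
          (by positivity)
    _ = (a⁻¹ ^ 6 / 12 + 1 / 6) * a⁻¹ ^ 6 * (((k : ℝ) + 1) ^ 6)⁻¹ := by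
        field_simp

/-- Weighted summability of the Lennard-Jones tail along an arithmetic progression: for `a > 0`
and `c ≥ 0` the series `Σ_k (k+1) · V(c + (k+1)a)` converges absolutely (comparison with
`Σ (k+1)⁻⁵`). [folklore] -/
theorem tailFzero_summable_mul_lennardJones {a c : ℝ} (ha : 0 < a) (hc : 0 ≤ c) :
    Summable (fun k : ℕ => ((k : ℝ) + 1) * lennardJones (c + ((k : ℝ) + 1) * a)) := by
  have hs5 : Summable (fun k : ℕ => (((k : ℝ) + 1) ^ 5)⁻¹) := by
    have := (summable_nat_add_iff 1).2 (Real.summable_nat_pow_inv.2 (by norm_num : 1 < 5))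
    simpa using this
  refine Summable.of_norm_bounded (hs5.mul_left ((a⁻¹ ^ 6 / 12 + 1 / 6) * a⁻¹ ^ 6)) fun k => ?_
  have hk : (0 : ℝ) < (k : ℝ) + 1 := by positivity
  rw [Real.norm_eq_abs, abs_mul, abs_of_pos hk]
  calc ((k : ℝ) + 1) * |lennardJones (c + ((k : ℝ) + 1) * a)|
      ≤ ((k : ℝ) + 1) * ((a⁻¹ ^ 6 / 12 + 1 / 6) * a⁻¹ ^ 6 * (((k : ℝ) + 1) ^ 6)⁻¹) :=
        mul_le_mul_of_nonneg_left (tailFzero_abs_lennardJones_shift_le ha hc k) hk.le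
    _ = (a⁻¹ ^ 6 / 12 + 1 / 6) * a⁻¹ ^ 6 * (((k : ℝ) + 1) ^ 5)⁻¹ := by
        field_simp

/-- Summability of the chain energy series `Σ_k V((k+1)a)` for `a > 0` (comparison with the weighted
series at offset `c = 0`). [folklore] -/
theorem tailFzero_summable_lennardJones {a : ℝ} (ha : 0 < a) :
    Summable (fun k : ℕ => lennardJones (((k : ℝ) + 1) * a)) := by
  have hf := (tailFzero_summable_mul_lennardJones ha le_rfl).norm
  refine Summable.of_norm_bounded hf fun k => ?_
  have hk : (0 : ℝ) < (k : ℝ) + 1 := by positivity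
  have hk1 : (1 : ℝ) ≤ (k : ℝ) + 1 := by linarith [(Nat.cast_nonneg k : (0 : ℝ) ≤ k)]
  simp only [zero_add, Real.norm_eq_abs, abs_mul, abs_of_pos hk]
  exact le_mul_of_one_le_left (abs_nonneg _) hk1

/-! ## The two telescoping identities -/

/-- (i) The tail interpolant pays the far field exactly: for `a > 0` and `x ≥ a`,
`Σ_k (k+1)[V(|x+a|+(k+1)a) − 2V(|x|+(k+1)a) + V(|x−a|+(k+1)a)] = V(x)` (partial sums
`K·V(x+(K+1)a) − (K+1)·V(x+Ka) + V(x)`, boundary terms `→ 0`). [folklore] -/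
theorem tailFzero_tail_eq {a x : ℝ} (ha : 0 < a) (hx : a ≤ x) :
    ∑' k : ℕ, ((k : ℝ) + 1) * (lennardJones (|x + a| + ((k : ℝ) + 1) * a)
      - 2 * lennardJones (|x| + ((k : ℝ) + 1) * a) + lennardJones (|x - a| + ((k : ℝ) + 1) * a)) =
      lennardJones x := by
  have hx0 : 0 < x := ha.trans_le hx
  rw [abs_of_pos (by linarith : 0 < x + a), abs_of_pos hx0, abs_of_nonneg (by linarith : 0 ≤ x - a)]
  -- closed form of the partial sums
  have hpartial : ∀ K : ℕ, ∑ k ∈ Finset.range K, ((k : ℝ) + 1) *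
      (lennardJones (x + a + ((k : ℝ) + 1) * a) - 2 * lennardJones (x + ((k : ℝ) + 1) * a)
        + lennardJones (x - a + ((k : ℝ) + 1) * a)) =
      (K : ℝ) * lennardJones (x + ((K : ℝ) + 1) * a) - ((K : ℝ) + 1) * lennardJones (x + (K : ℝ) * a)
        + lennardJones x := by
    intro K
    induction K with
    | zero => simp
    | succ K ih =>
      rw [Finset.sum_range_succ, ih]
      push_cast
      rw [show x + a + ((K : ℝ) + 1) * a = x + ((K : ℝ) + 1 + 1) * a by ring,
        show x - a + ((K : ℝ) + 1) * a = x + (K : ℝ) * a by ring]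
      ring
  -- summability of the series
  have hsum : Summable (fun k : ℕ => ((k : ℝ) + 1) *
      (lennardJones (x + a + ((k : ℝ) + 1) * a) - 2 * lennardJones (x + ((k : ℝ) + 1) * a)
        + lennardJones (x - a + ((k : ℝ) + 1) * a))) := by
    have h1 := tailFzero_summable_mul_lennardJones ha (c := x + a) (by linarith)
    have h2 := tailFzero_summable_mul_lennardJones ha (c := x) (by linarith)
    have h3 := tailFzero_summable_mul_lennardJones ha (c := x - a) (by linarith)
    refine ((h1.sub (h2.mul_left 2)).add h3).congr fun k => ?_
    ring
  -- the two boundary terms tend to zero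
  have hA : Tendsto (fun K : ℕ => (K : ℝ) * lennardJones (x + ((K : ℝ) + 1) * a)) atTop (𝓝 0) := by
    rw [← tendsto_add_atTop_iff_nat 1]
    refine (tailFzero_summable_mul_lennardJones ha (c := x + a)
      (by linarith)).tendsto_atTop_zero.congr fun K => ?_
    push_cast
    rw [show x + a + ((K : ℝ) + 1) * a = x + ((K : ℝ) + 1 + 1) * a by ring]
  have hB : Tendsto (fun K : ℕ => ((K : ℝ) + 1) * lennardJones (x + (K : ℝ) * a)) atTop (𝓝 0) := by
    refine (tailFzero_summable_mul_lennardJones ha (c := x - a)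
      (by linarith)).tendsto_atTop_zero.congr fun K => ?_
    rw [show x - a + ((K : ℝ) + 1) * a = x + (K : ℝ) * a by ring]
  have hlim := ((hA.sub hB).add_const (lennardJones x)).congr fun K => (hpartial K).symm
  rw [tendsto_nhds_unique hsum.hasSum.tendsto_sum_nat hlim]
  ring

/-- (ii) The value at the origin: for `a > 0`,
`Σ_k (k+1)[V(a+(k+1)a) − 2V((k+1)a) + V(a+(k+1)a)] = −2 Σ_k V((k+1)a)` (partial sums
`2K·V((K+1)a) − 2 Σ_{k<K} V((k+1)a)`). [folklore] -/
theorem tailFzero_zero_eq {a : ℝ} (ha : 0 < a) :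
    ∑' k : ℕ, ((k : ℝ) + 1) * (lennardJones (a + ((k : ℝ) + 1) * a) - 2 * lennardJones (((k : ℝ) + 1) * a)
      + lennardJones (a + ((k : ℝ) + 1) * a)) = -2 * ∑' k : ℕ, lennardJones (((k : ℝ) + 1) * a) := by
  -- closed form of the partial sums
  have hpartial : ∀ K : ℕ, ∑ k ∈ Finset.range K, ((k : ℝ) + 1) *
      (lennardJones (a + ((k : ℝ) + 1) * a) - 2 * lennardJones (((k : ℝ) + 1) * a)
        + lennardJones (a + ((k : ℝ) + 1) * a)) =
      2 * ((K : ℝ) * lennardJones (a + (K : ℝ) * a))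
        - 2 * ∑ k ∈ Finset.range K, lennardJones (((k : ℝ) + 1) * a) := by
    intro K
    induction K with
    | zero => simp
    | succ K ih =>
      rw [Finset.sum_range_succ, Finset.sum_range_succ, ih]
      push_cast
      rw [show a + (K : ℝ) * a = ((K : ℝ) + 1) * a by ring]
      ring
  -- summability of the series
  have hsum : Summable (fun k : ℕ => ((k : ℝ) + 1) *
      (lennardJones (a + ((k : ℝ) + 1) * a) - 2 * lennardJones (((k : ℝ) + 1) * a)
        + lennardJones (a + ((k : ℝ) + 1) * a))) := by
    have h1 := tailFzero_summable_mul_lennardJones ha ha.le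
    have h2 : Summable (fun k : ℕ => ((k : ℝ) + 1) * lennardJones (((k : ℝ) + 1) * a)) :=
      (tailFzero_summable_mul_lennardJones ha le_rfl).congr fun k => by rw [zero_add]
    refine ((h1.sub (h2.mul_left 2)).add h1).congr fun k => ?_
    ring
  -- the boundary term tends to zero, the chain sum converges
  have hA : Tendsto (fun K : ℕ => (K : ℝ) * lennardJones (a + (K : ℝ) * a)) atTop (𝓝 0) := by
    rw [← tendsto_add_atTop_iff_nat 1]
    refine (tailFzero_summable_mul_lennardJones ha ha.le).tendsto_atTop_zero.congr fun K => ?_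
    push_cast
    ring
  have hS : Tendsto (fun K : ℕ => ∑ k ∈ Finset.range K, lennardJones (((k : ℝ) + 1) * a)) atTop
      (𝓝 (∑' k : ℕ, lennardJones (((k : ℝ) + 1) * a))) :=
    (tailFzero_summable_lennardJones ha).hasSum.tendsto_sum_nat
  have hlim := ((hA.const_mul 2).sub (hS.const_mul 2)).congr fun K => (hpartial K).symm
  rw [tendsto_nhds_unique hsum.hasSum.tendsto_sum_nat hlim]
  ring

/-- **Registered stub `stub_tailFzero`** (telescoping identities of the retarded Green's function of
`Δ_a`): for every `a > 0`, (i) `F_a = V` on `[a, ∞)` and (ii) `F_a(0) = −2 Σ_{m ≥ 1} V(m a)`, where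
`F_a(x) = Σ_{k ≥ 0} (k+1)[V(|x+a|+(k+1)a) − 2V(|x|+(k+1)a) + V(|x−a|+(k+1)a)]`. [folklore] -/
theorem stub_tailFzero : ∀ a : ℝ, 0 < a →
    (∀ x : ℝ, a ≤ x → ∑' k : ℕ, ((k : ℝ) + 1) * (lennardJones (|x + a| + ((k : ℝ) + 1) * a)
      - 2 * lennardJones (|x| + ((k : ℝ) + 1) * a) + lennardJones (|x - a| + ((k : ℝ) + 1) * a)) = lennardJones x) ∧
    (∑' k : ℕ, ((k : ℝ) + 1) * (lennardJones (a + ((k : ℝ) + 1) * a) - 2 * lennardJones (((k : ℝ) + 1) * a)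
      + lennardJones (a + ((k : ℝ) + 1) * a)) = -2 * ∑' k : ℕ, lennardJones (((k : ℝ) + 1) * a)) :=
  fun _ ha => ⟨fun _ hx => tailFzero_tail_eq ha hx, tailFzero_zero_eq ha⟩

end Summit.AtomisticToContinuum.Crystallization.Theorems.ThreeConeCertificateExactCertificate.Transfer1D

end
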